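/-
Copyright (c) 2026 the pub-hodgecm-mathlib formalisation cell (harness21).  Prover seat hodgecm-mathlib-LH4-p18 (g3), Track A «FOUR-FRAME» hand on VALVE loan to
Track B «K2-LIT», #184♮ = hLiu418 = `stmt-HodgeConjecture-24832`; desk K2Liu-p14 (g4) DESK WORD #6 (b) ∕ HANDOFF memo :16, task (P-supp-lat), file (lat-d): the LOCAL
payer of the one by-value letter `hloc` of ★ p863726 (lat-c) `K2LiuKindOneLineLatticeLetters.hlatU_of_latticeLocal` at the socket rank `n = 2`, and the
unconditional `hlatU` of ★ p863630 `K2LiuKindOneLineTermOfRecord`.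
THEOREMS ONLY (no `def`, no `instance`, no notation, no named-fact hypothesis, no `sorry`).
-/
import Summits.HodgeConjecture.HodgeConjecture.Theorems.K2LiuKindOneLineLatticeLocalPrelims   -- (lat-d′) tools: defects, conductor, `e ≤ 2`, Gram letters, the test step, bookkeeping
import HarnessLib

/-!
# Crux `HLiu418`, socket #42F′ (kind-one line term), file (lat-d) — `K2LiuKindOneLineLatticeLocal`:
# THE LOCAL LATTICE LETTER `hloc` OF ★ (lat-c), PAID AT `n = 2`, AND THE UNCONDITIONAL `hlatU`

Cell `hodgecm-mathlib`, crux item hLiu418 = `stmt-HodgeConjecture-24832` (helper lane `--supports … --as helper`, count-neutral), route of record `HCCMUnconditional`;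
squad K2 ∕ K2Liu, road `K2_Liu`, desk K2Liu-p14 DESK WORD #6 (b): `hlatU` of ★ p863630 `K2LiuKindOneLineTermOfRecord` is ★ (lat-c) `hlatU_of_latticeLocal` applied to ONE
by-value local letter `hloc`; THIS FILE pays `hloc` at the socket rank `n = 2` (`e : Fin N × Fin M ≃ Fin 2`) — §1 `exists_latticeLocal` — and closes `hlatU`
unconditionally — §2 **`hlatU_holds`**.

THE LOCAL LETTER (★ (lat-c), slope 2, `w`-indexed defect): `∃ D Bad, (∀ w ∉ Bad, D w = 0) ∧ ∀ v (w ∣ v) (Mv : ℕ) (S ∈ Skew(T^R ⊗ L))`, IF `χ_S(ι_v u) = 1` for every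
`u ∈ H(L⁺_v)` with all components `u_{w′} ∈ K_{w′}(ϖ_{w′}^{Mv})` and `ι_v u ∈ N_Δ(𝔸)`, THEN `|S_{ab}|_w ≤ exp(2·Mv + D_w)` for all entries.
THE PROOF.  Test `χ_S` on the local Siegel unipotents `n(t)` of the four elementary `T^R`-skew test blocks `t` of ★ p863078 §2 (`skew_test01/10/00/11`) at `v`-depth
`N := Mv + 2(c_w + c_{c⁻¹•w})`, `c := c₂ + c_δ + c_{g₀} + c_{g₁}` the unit defects (prelims §1) of `2`, `δ_L`, `g₀ = T^R₀₀`, `g₁ = T^R₁₁`: every `w′`-entry of `t` is then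
`≤ |2|_{w′}·|ϖ_{w′}|^{Mv}` (prelims §6; the places over `v` are `w`, `c⁻¹•w`), so the TEST STEP (prelims §5 `addChar_trace_eq_one_of_prem`: deep at every place by
★ (lat-a) ED.2, in `N_Δ(𝔸)`, read by ★ `unipDeltaChar_locToAdelic_nElem`) turns the premise of `hloc` into the four `htest··` letters of ★ p863515
`valued_entry_mul_le_of_forall_test` (`ψ_v` of conductor exponent `d_v`, prelims §2; `τ := Tr`), whose conclusion `|2|_w|δ|_w|S_{ab}|_w ≤ max(|δ|_w,1)·exp(e(w|v)(N − d_v))`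
(`e ≤ 2`, prelims §3) gives `|S_{ab}|_w ≤ exp(2Mv + D_w)` with `D_w := c₂(w) + 2c_δ(w) + 4(c_w + c_{c⁻¹•w}) + 2|d_{w∩L⁺}|`, zero off a finite set (`c` a.e. `0`,
injectivity of the Galois action, ★ `tendsto_under_cofinite`).
[Shimura1997, §18.4, §20.1] [MoeglinWaldspurger1995, I.2.6] [Tate1950, §2.2, §4.1] [PlatonovRapinchuk1994, §5.1].
HONEST LABEL.  Count-neutral helpers, close no socket; with ★ (lat-c) this pays DESK WORD #6 (b) `hlatU` in full (§2): `HC_CM` is proved only modulo the 7 printed citations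
(2 remaining named inputs: hLiu418 = `stmt-HodgeConjecture-24832`, h413 = `stmt-HodgeConjecture-24833`) until rung 0 closes.

## References
* [Shimura1997] G. Shimura, *Euler Products and Eisenstein Series*, CBMS 93 (1997): §18.4 (Fourier coefficients along the Siegel unipotent), §20.1 (denominators).
* [MoeglinWaldspurger1995] C. Moeglin, J.-L. Waldspurger, *Spectral Decomposition and Eisenstein Series* (1995): I.2.6 (Fourier expansion along `N(F)\N(𝔸)`).
* [Tate1950] J. Tate, *Fourier analysis in number fields and Hecke's zeta-functions* (1950): §2.2 (local additive characters, conductor), §4.1 (almost all unramified).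
* [PlatonovRapinchuk1994] V. Platonov, A. Rapinchuk, *Algebraic Groups and Number Theory* (1994): §5.1 (principal congruence subgroups).
-/

set_option autoImplicit false
set_option linter.dupNamespace false -- the mandated namespace repeats `HodgeConjecture.HodgeConjecture`

noncomputable section

open scoped NNReal MatrixGroups Matrix
open NumberField IsDedekindDomain Matrix ValuativeRel Filter
open Literature.NumberTheory.Automorphic Literature.NumberTheory.Automorphic.UnitaryGroup Literature.NumberTheory.GaloisRepresentations
open Literature.NumberTheory.GelbartRogawski1991 Literature.NumberTheory.GelbartRogawski1991.GRConstruction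
open Literature.NumberTheory.GelbartRogawski1991.AdaptedBlocks
open Literature.NumberTheory.GelbartRogawski1991.UnitaryDualPair Literature.NumberTheory.GelbartRogawski1991.UnitaryDualPair.LocalSplitting
open Literature.NumberTheory.K2Lit Literature.NumberTheory.K2Lit.SiegelDoubled Literature.NumberTheory.K2Lit.LocalSiegelDoubled
open Summit.HodgeConjecture.HodgeConjecture.Cruxes.HLiu418.K2LiuSiegelUnipotentFourierDefs (unipDeltaChar skewMatrices)
open Summit.HodgeConjecture.HodgeConjecture.Cruxes.HLiu418.K2LiuLocalLFactorDefs (unifAt)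
open Summit.HodgeConjecture.HodgeConjecture.Cruxes.HLiu418.K2LiuKindOneLineLatticeLetters (hlatU_of_latticeLocal)
open Summit.HodgeConjecture.HodgeConjecture.Cruxes.HLiu418.K2LiuKindOneLineCharacterReading (algebraMap_localRing_apply)
open Summit.HodgeConjecture.HodgeConjecture.Cruxes.HLiu418.K2LiuKindOneLineCharacterBoundTwo (skew_test01 skew_test10 skew_test00 skew_test11)
open Summit.HodgeConjecture.HodgeConjecture.Cruxes.HLiu418.K2LiuKindOneLineCharacterBoundTwoGeneral (valued_entry_mul_le_of_forall_test)
open Summit.HodgeConjecture.HodgeConjecture.Cruxes.HLiu418.K2LiuTateCharacterLocalTrace (toLocalRing_algebraTrace algebraTrace_toLocalRing_mul)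
open Summit.HodgeConjecture.HodgeConjecture.Cruxes.HLiu418.K2LiuKindOneLineLatticeLocalPrelims

namespace Summit.HodgeConjecture.HodgeConjecture.Cruxes.HLiu418.K2LiuKindOneLineLatticeLocal

variable (L : Type) [Field L] [NumberField L] [IsCMField L]
variable {N M : ℕ} (e : Fin N × Fin M ≃ Fin 2)
  (dV : Fin N → L) (hdV : ∀ i, IsCMField.complexConj L (dV i) = dV i)
  (dW : Fin M → L) (hdW : ∀ i, IsCMField.complexConj L (dW i) = dW i)

/-! ## §1 The local lattice letter, paid -/

/-- **THE LOCAL LATTICE LETTER `hloc` OF ★ (lat-c) `hlatU_of_latticeLocal`, AT `n = 2`.**  There are defects `D : w ↦ ℕ`, zero off a finite set `Bad` of places of `L`, such that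
for every place `v` of `L⁺`, every `w ∣ v`, every depth `Mv` and every `S ∈ Skew(T^R ⊗ L)`: if `χ_S(ι_v u) = 1` for all `u ∈ H(L⁺_v)` with components in `K_{w′}(ϖ_{w′}^{Mv})`
(`w′ ∣ v`) and `ι_v u ∈ N_Δ(𝔸)`, then `|S_{ab}|_w ≤ exp(2·Mv + D_w)` for all `a b` (module docstring for the proof).
[cite: Shimura1997, §18.4, §20.1] [cite: MoeglinWaldspurger1995, I.2.6] [cite: Tate1950, §2.2] -/
theorem exists_latticeLocal (hdV0 : ∀ i, dV i ≠ 0) (hdW0 : ∀ i, dW i ≠ 0) :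
    ∃ (D : HeightOneSpectrum (𝓞 L) → ℕ) (Bad : Finset (HeightOneSpectrum (𝓞 L))), (∀ w ∉ Bad, D w = 0) ∧
      ∀ (v : HeightOneSpectrum (𝓞 (Fp L))) (w : UnitaryGroup.PlacesOver L v) (Mv : ℕ)
        (S : skewMatrices ((IsCMField.complexConj L : L ≃ₐ[Fp L] L) : L →+* L) ((gramR L e dV hdV dW hdW).map (algebraMap (Fp L) L))),
        (∀ u : UnitaryGroup.localPi L (IsCMField.complexConj L) (2 + 2) (hermD L e dV hdV dW hdW) v,
            (∀ w' : UnitaryGroup.PlacesOver L v,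
              (u : UnitaryGroup.LocalGLPi L (2 + 2) v) w' ∈ congruenceGL (2 + 2) (valuation (w'.1.adicCompletion L) (unifAt L w'.1) ^ Mv)) →
            (locToAdelic L e dV hdV dW hdW v u : HA L e dV hdV dW hdW) ∈ unipDelta L e dV hdV dW hdW →
            unipDeltaChar L e dV hdV dW hdW (S : Matrix (Fin 2) (Fin 2) L) (locToAdelic L e dV hdV dW hdW v u) = 1) →
        ∀ a b, Valued.v ((((S : Matrix (Fin 2) (Fin 2) L) a b : L)) : w.1.adicCompletion L) ≤ WithZero.exp (2 * (Mv : ℤ) + D w.1) := by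
  classical
  -- the unit defects of `2`, `δ`, `g₀`, `g₁` and the conductor exponents (prelims §1–§2)
  obtain ⟨c₂, hc₂ev, hc₂⟩ := exists_defect L (two_ne_zero : (2 : L) ≠ 0)
  obtain ⟨cδ, hcδev, hcδ⟩ := exists_defect L (imagUnit_ne_zero L)
  obtain ⟨cg₀, hcg₀ev, hcg₀⟩ := exists_defect L
    ((map_ne_zero (algebraMap (Fp L) L)).2 (gramR_diag_ne_zero L e dV hdV dW hdW hdV0 hdW0 0))
  obtain ⟨cg₁, hcg₁ev, hcg₁⟩ := exists_defect L
    ((map_ne_zero (algebraMap (Fp L) L)).2 (gramR_diag_ne_zero L e dV hdV dW hdW hdV0 hdW0 1))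
  obtain ⟨d, hdev, hd⟩ := exists_conductorExp (Fp L)
  obtain ⟨c, hc⟩ : ∃ c : HeightOneSpectrum (𝓞 L) → ℕ, ∀ w, c w = c₂ w + cδ w + cg₀ w + cg₁ w :=
    ⟨fun w => c₂ w + cδ w + cg₀ w + cg₁ w, fun _ => rfl⟩
  obtain ⟨D, hD⟩ : ∃ D : HeightOneSpectrum (𝓞 L) → ℕ, ∀ w, D w =
      c₂ w + 2 * cδ w + 4 * (c w + c ((IsCMField.complexConj L)⁻¹ • w)) + 2 * (d (w.under (𝓞 (Fp L)))).natAbs :=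
    ⟨fun w => c₂ w + 2 * cδ w + 4 * (c w + c ((IsCMField.complexConj L)⁻¹ • w)) + 2 * (d (w.under (𝓞 (Fp L)))).natAbs, fun _ => rfl⟩
  -- `D = 0` off a finite set
  have hcev : ∀ᶠ w : HeightOneSpectrum (𝓞 L) in cofinite, c w = 0 := by
    filter_upwards [hc₂ev, hcδev, hcg₀ev, hcg₁ev] with w e1 e2 e3 e4
    rw [hc, e1, e2, e3, e4]
  have hDev : ∀ᶠ w : HeightOneSpectrum (𝓞 L) in cofinite, D w = 0 := by
    have h2 : ∀ᶠ w : HeightOneSpectrum (𝓞 L) in cofinite, c ((IsCMField.complexConj L)⁻¹ • w) = 0 :=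
      (MulAction.injective (β := HeightOneSpectrum (𝓞 L)) (IsCMField.complexConj L)⁻¹).tendsto_cofinite.eventually hcev
    have h3 : ∀ᶠ w : HeightOneSpectrum (𝓞 L) in cofinite, d (w.under (𝓞 (Fp L))) = 0 :=
      (HeightOneSpectrum.tendsto_under_cofinite (A := 𝓞 (Fp L)) (B := 𝓞 L)).eventually hdev
    filter_upwards [hc₂ev, hcδev, hcev, h2, h3] with w e1 e2 e3 e4 e5
    rw [hD, e1, e2, e3, e4, e5, Int.natAbs_zero]
  have hfin := Filter.eventually_cofinite.1 hDev
  refine ⟨D, hfin.toFinset, fun w hw => by_contra fun hne => hw (hfin.mem_toFinset.2 hne), ?_⟩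
  -- the local argument
  intro v w Mv S hprem a b
  -- Gram letters at `v`
  have hg : ∀ k : Fin 2, ((gramR L e dV hdV dW hdW k k : Fp L) : v.adicCompletion (Fp L)) ≠ 0 := by
    intro k h0
    have h1 := congrArg Valued.v h0
    rw [HeightOneSpectrum.valuedAdicCompletion_eq_valuation', map_zero] at h1
    exact (Valuation.ne_zero_iff _).2 (gramR_diag_ne_zero L e dV hdV dW hdW hdV0 hdW0 k) h1
  have hz0 : ((0 : Fp L) : v.adicCompletion (Fp L)) = 0 :=
    (Valuation.zero_iff (Valued.v : Valuation (v.adicCompletion (Fp L)) _)).1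
      (by rw [HeightOneSpectrum.valuedAdicCompletion_eq_valuation', map_zero])
  have hG01 : LocalSplitting.gramS (Fp L) L v 2 (gramR L e dV hdV dW hdW) 0 1 = 0 := by
    rw [gramS_apply, gramR_offDiag L e dV hdV dW hdW (show (0 : Fin 2) ≠ 1 by decide), hz0, map_zero]
  have hG10 : LocalSplitting.gramS (Fp L) L v 2 (gramR L e dV hdV dW hdW) 1 0 = 0 := by
    rw [gramS_apply, gramR_offDiag L e dV hdV dW hdW (show (1 : Fin 2) ≠ 0 by decide), hz0, map_zero]
  have hσσ : ∀ r : LocalRing L v, conjLocal L (IsCMField.complexConj L) v (conjLocal L (IsCMField.complexConj L) v r) = r :=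
    conjLocal_conjLocal (F := Fp L) (E := L) (c := IsCMField.complexConj L) v (complexConj_imagUnit L) (imagUnit_ne_zero L)
  have hGσ : ∀ k : Fin 2, conjLocal L (IsCMField.complexConj L) v (LocalSplitting.gramS (Fp L) L v 2 (gramR L e dV hdV dW hdW) k k) =
      LocalSplitting.gramS (Fp L) L v 2 (gramR L e dV hdV dW hdW) k k := fun k => by
    rw [gramS_apply, conjLocal_toLocalRing]
  have hginv : ∀ k : Fin 2, LocalSplitting.gramS (Fp L) L v 2 (gramR L e dV hdV dW hdW) k k *
      toLocalRing L v ((gramR L e dV hdV dW hdW k k : Fp L) : v.adicCompletion (Fp L))⁻¹ = 1 := fun k => by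
    rw [gramS_apply, ← map_mul, mul_inv_cancel₀ (hg k), map_one]
  have hginvσ : ∀ k : Fin 2, conjLocal L (IsCMField.complexConj L) v (toLocalRing L v ((gramR L e dV hdV dW hdW k k : Fp L) : v.adicCompletion (Fp L))⁻¹) =
      toLocalRing L v ((gramR L e dV hdV dW hdW k k : Fp L) : v.adicCompletion (Fp L))⁻¹ := fun k => by
    rw [conjLocal_toLocalRing]
  -- valuation bookkeeping at the places `w′ ∣ v`
  have hGv : ∀ (w' : UnitaryGroup.PlacesOver L v) (k : Fin 2),
      Valued.v (LocalSplitting.gramS (Fp L) L v 2 (gramR L e dV hdV dW hdW) k k w') ≤ WithZero.exp ((cg₀ w'.1 + cg₁ w'.1 : ℕ) : ℤ) := by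
    intro w' k
    rw [gramS_apply, toLocalRing_apply, toPlace_coe]
    fin_cases k
    · exact (hcg₀ w'.1).1.trans (WithZero.exp_le_exp.2 (by push_cast; omega))
    · exact (hcg₁ w'.1).1.trans (WithZero.exp_le_exp.2 (by push_cast; omega))
  have hGinv : ∀ (w' : UnitaryGroup.PlacesOver L v) (k : Fin 2),
      Valued.v (toLocalRing L v ((gramR L e dV hdV dW hdW k k : Fp L) : v.adicCompletion (Fp L))⁻¹ w') ≤ WithZero.exp ((cg₀ w'.1 + cg₁ w'.1 : ℕ) : ℤ) := by
    intro w' k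
    rw [toLocalRing_apply, map_inv₀, toPlace_coe, map_inv₀]
    fin_cases k
    · exact (inv_le_exp_of_exp_neg_le (hcg₀ w'.1).2).trans (WithZero.exp_le_exp.2 (by push_cast; omega))
    · exact (inv_le_exp_of_exp_neg_le (hcg₁ w'.1).2).trans (WithZero.exp_le_exp.2 (by push_cast; omega))
  -- the test depth
  obtain ⟨Nn, hNn⟩ : ∃ Nn : ℕ, Nn = Mv + 2 * (c w.1 + c ((IsCMField.complexConj L)⁻¹ • w.1)) :=
    ⟨Mv + 2 * (c w.1 + c ((IsCMField.complexConj L)⁻¹ • w.1)), rfl⟩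
  have hcle : ∀ w' : UnitaryGroup.PlacesOver L v, c w'.1 ≤ c w.1 + c ((IsCMField.complexConj L)⁻¹ • w.1) := fun w' => apply_le_of_placesOver L c w w'
  -- the bound on the `y`'s of the off-diagonal tests
  have hyB : ∀ y : LocalRing L v, (y = 1 ∨ y = algebraMap L (LocalRing L v) (imagUnit L)) → ∀ w' : UnitaryGroup.PlacesOver L v,
      Valued.v (y w') ≤ WithZero.exp (cδ w'.1 : ℤ) ∧ Valued.v (conjLocal L (IsCMField.complexConj L) v y w') ≤ WithZero.exp (cδ w'.1 : ℤ) := by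
    rintro y (rfl | rfl) w'
    · rw [map_one, Pi.one_apply, map_one]
      exact ⟨one_le_exp_natCast _, one_le_exp_natCast _⟩
    · rw [conjLocal_algebraMap, complexConj_imagUnit, map_neg, Pi.neg_apply, Valuation.map_neg, algebraMap_localRing_apply]
      exact ⟨(hcδ w'.1).1, (hcδ w'.1).1⟩
  -- entry bounds: `ι u · y` and `−(G_kk · ι g⁻¹ · σ(ι u · y))`
  have hE1 : ∀ {u : v.adicCompletion (Fp L)}, Valued.v u ≤ WithZero.exp (-(Nn : ℤ)) → ∀ {y : LocalRing L v},
      (y = 1 ∨ y = algebraMap L (LocalRing L v) (imagUnit L)) → ∀ w' : UnitaryGroup.PlacesOver L v,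
      Valued.v ((toLocalRing L v u * y) w') ≤ Valued.v ((2 : L) : w'.1.adicCompletion L) * WithZero.exp (-(Mv : ℤ)) := by
    intro u hu y hy w'
    refine le_two_mul_exp_of_le (valued_toLocalRing_mul_apply_le L v w' hu (hyB y hy w').1) (hc₂ w'.1).2 ?_
    have h1 := hcle w'; have h2 := hc w'.1; omega
  have hE2 : ∀ {u : v.adicCompletion (Fp L)}, Valued.v u ≤ WithZero.exp (-(Nn : ℤ)) → ∀ {y : LocalRing L v},
      (y = 1 ∨ y = algebraMap L (LocalRing L v) (imagUnit L)) → ∀ (w' : UnitaryGroup.PlacesOver L v) (k l : Fin 2),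
      Valued.v ((-(LocalSplitting.gramS (Fp L) L v 2 (gramR L e dV hdV dW hdW) k k *
          toLocalRing L v ((gramR L e dV hdV dW hdW l l : Fp L) : v.adicCompletion (Fp L))⁻¹ *
          conjLocal L (IsCMField.complexConj L) v (toLocalRing L v u * y))) w') ≤
        Valued.v ((2 : L) : w'.1.adicCompletion L) * WithZero.exp (-(Mv : ℤ)) := by
    intro u hu y hy w' k l
    have hr : Valued.v (conjLocal L (IsCMField.complexConj L) v (toLocalRing L v u * y) w') ≤ WithZero.exp (-(Nn : ℤ) + cδ w'.1) := by
      rw [map_mul, conjLocal_toLocalRing]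
      exact valued_toLocalRing_mul_apply_le L v w' hu (hyB y hy w').2
    refine le_two_mul_exp_of_le (valued_neg_mul_mul_apply_le L v w' (hGv w' k) (hGinv w' l) hr) (hc₂ w'.1).2 ?_
    have h1 := hcle w'; have h2 := hc w'.1; omega
  -- the local trace `τ := Tr_{L⊗L⁺_v/L⁺_v}` and the scalar lemma ★ p863515
  have hτ := toLocalRing_algebraTrace L v (IsCMField.complexConj L) (complexConj_imagUnit L) (imagUnit_ne_zero L)
  have hskew := skew_map L e dV hdV dW hdW v S
  have hslack := ramification_slack (d := d v) (Int.natCast_nonneg (v.asIdeal.ramificationIdx' w.1.asIdeal))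
    (by exact_mod_cast ramificationIdx_le_two L v w) (Int.natCast_nonneg Nn)
  have hdv : d (w.1.under (𝓞 (Fp L))) = d v := by rw [w.2]
  refine le_exp_of_mul_mul_le (hc₂ w.1).2 (hcδ w.1).2 (hcδ w.1).1
    (valued_entry_mul_le_of_forall_test L v (hd v) hτ (fun r r' => map_add _ r r') (fun z r => algebraTrace_toLocalRing_mul L v z r) w
      (LocalSplitting.gramS (Fp L) L v 2 (gramR L e dV hdV dW hdW)) hG01 hG10 (hg 0) (hg 1) rfl rfl (S : Matrix (Fin 2) (Fin 2) L) hskew (Nn : ℤ)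
      ?_ ?_ ?_ ?_ a b) ?_
  · -- test `(0,1)`
    intro u hu y hy
    exact addChar_trace_eq_one_of_prem L e dV hdV dW hdW v Mv (S : Matrix (Fin 2) (Fin 2) L) hprem
      (skew_test01 (conjLocal L (IsCMField.complexConj L) v) hσσ _ hG01 hG10 (hGσ 0) _ (hginv 1) (hginvσ 1) _)
      fun w' => forall_fin_two_apply (fun z : LocalRing L v => Valued.v (z w') ≤ Valued.v ((2 : L) : w'.1.adicCompletion L) * WithZero.exp (-(Mv : ℤ)))
        (valued_zero_apply_le L w' _) (hE1 hu hy w') (hE2 hu hy w' 0 1) (valued_zero_apply_le L w' _)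
  · -- test `(1,0)`
    intro u hu y hy
    exact addChar_trace_eq_one_of_prem L e dV hdV dW hdW v Mv (S : Matrix (Fin 2) (Fin 2) L) hprem
      (skew_test10 (conjLocal L (IsCMField.complexConj L) v) hσσ _ hG01 hG10 (hGσ 1) _ (hginv 0) (hginvσ 0) _)
      fun w' => forall_fin_two_apply (fun z : LocalRing L v => Valued.v (z w') ≤ Valued.v ((2 : L) : w'.1.adicCompletion L) * WithZero.exp (-(Mv : ℤ)))
        (valued_zero_apply_le L w' _) (hE2 hu hy w' 1 0) (hE1 hu hy w') (valued_zero_apply_le L w' _)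
  · -- test `(0,0)`
    intro u hu
    have hz : conjLocal L (IsCMField.complexConj L) v (toLocalRing L v u * algebraMap L (LocalRing L v) (imagUnit L)) =
        -(toLocalRing L v u * algebraMap L (LocalRing L v) (imagUnit L)) := by
      rw [map_mul, conjLocal_toLocalRing, conjLocal_algebraMap, complexConj_imagUnit, map_neg, mul_neg]
    exact addChar_trace_eq_one_of_prem L e dV hdV dW hdW v Mv (S : Matrix (Fin 2) (Fin 2) L) hprem
      (skew_test00 (conjLocal L (IsCMField.complexConj L) v) _ hG01 hG10 hz)
      fun w' => forall_fin_two_apply (fun z : LocalRing L v => Valued.v (z w') ≤ Valued.v ((2 : L) : w'.1.adicCompletion L) * WithZero.exp (-(Mv : ℤ)))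
        (hE1 hu (Or.inr rfl) w') (valued_zero_apply_le L w' _) (valued_zero_apply_le L w' _) (valued_zero_apply_le L w' _)
  · -- test `(1,1)`
    intro u hu
    have hz : conjLocal L (IsCMField.complexConj L) v (toLocalRing L v u * algebraMap L (LocalRing L v) (imagUnit L)) =
        -(toLocalRing L v u * algebraMap L (LocalRing L v) (imagUnit L)) := by
      rw [map_mul, conjLocal_toLocalRing, conjLocal_algebraMap, complexConj_imagUnit, map_neg, mul_neg]
    exact addChar_trace_eq_one_of_prem L e dV hdV dW hdW v Mv (S : Matrix (Fin 2) (Fin 2) L) hprem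
      (skew_test11 (conjLocal L (IsCMField.complexConj L) v) _ hG01 hG10 hz)
      fun w' => forall_fin_two_apply (fun z : LocalRing L v => Valued.v (z w') ≤ Valued.v ((2 : L) : w'.1.adicCompletion L) * WithZero.exp (-(Mv : ℤ)))
        (valued_zero_apply_le L w' _) (valued_zero_apply_le L w' _) (valued_zero_apply_le L w' _) (hE1 hu (Or.inr rfl) w')
  · -- the output arithmetic
    rw [hD, hdv]
    omega

/-! ## §2 The `hlatU` letter of the term of record, unconditionally -/

/-- **`hlatU` OF ★ p863630 `K2LiuKindOneLineTermOfRecord.exists_kindOne_lineTerm_of_record`, PAID** (socket rank `n = 2`, `e : Fin N × Fin M ≃ Fin 2`): ★ (lat-c)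
`hlatU_of_latticeLocal` fed with §1 `exists_latticeLocal`.  For every OPEN `U ≤ H(𝔸_{L⁺,f})` there are `Tδ`, `δ` (`= 0` off `Tδ`) and `k` such that, whenever `χ_S`
is trivial on the `b ∈ N_Δ(𝔸)` with `b_∞ = 1` and `(h⁻¹ b h)_f ∈ U`, `|S_{ab}|_w ≤ q_w^m` with `q_w^m ≤ q_w^{δ_w}·H_w(h)^k` at every finite place `w` of `L`.
[cite: Shimura1997, §18.4, §20.1] [cite: BorelJacquet1979, §1.2, §4.1] [cite: MoeglinWaldspurger1995, I.2.6] -/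
theorem hlatU_holds (hdV0 : ∀ i, dV i ≠ 0) (hdW0 : ∀ i, dW i ≠ 0) :
    ∀ U : Subgroup (UnitaryGroup.finAdelic (Fp L) L (IsCMField.complexConj L) (2 + 2) (hermD L e dV hdV dW hdW)),
      IsOpen (U : Set (UnitaryGroup.finAdelic (Fp L) L (IsCMField.complexConj L) (2 + 2) (hermD L e dV hdV dW hdW))) →
      ∃ (Tδ : Finset (HeightOneSpectrum (𝓞 L))) (δ : HeightOneSpectrum (𝓞 L) → ℕ) (k : ℕ), (∀ w ∉ Tδ, δ w = 0) ∧
        ∀ (S : skewMatrices ((IsCMField.complexConj L : L ≃ₐ[Fp L] L) : L →+* L) ((gramR L e dV hdV dW hdW).map (algebraMap (Fp L) L)))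
          (h : HA L e dV hdV dW hdW),
          (∀ b : unipDelta L e dV hdV dW hdW,
            UnitaryGroup.archPart (Fp L) L (IsCMField.complexConj L) (2 + 2) (hermD L e dV hdV dW hdW) (b : HA L e dV hdV dW hdW) = 1 →
            UnitaryGroup.finPart (Fp L) L (IsCMField.complexConj L) (2 + 2) (hermD L e dV hdV dW hdW) (h⁻¹ * (b : HA L e dV hdV dW hdW) * h) ∈ U →
            unipDeltaChar L e dV hdV dW hdW (S : Matrix (Fin 2) (Fin 2) L) (b : HA L e dV hdV dW hdW) = 1) →
          ∀ w : HeightOneSpectrum (𝓞 L), ∃ m : ℕ,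
            ((Ideal.absNorm w.asIdeal : ℕ) : ℝ) ^ m ≤
                ((Ideal.absNorm w.asIdeal : ℕ) : ℝ) ^ δ w * (GLn.localHeight (2 + 2) L w (h : GL (Fin (2 + 2)) (AdeleRing (𝓞 L) L)) : ℝ) ^ k ∧
              ∀ a b, Valued.v ((((S : Matrix (Fin 2) (Fin 2) L) a b : L)) : w.adicCompletion L) ≤ WithZero.exp (m : ℤ) := by
  obtain ⟨D, Bad, hD, hloc⟩ := exists_latticeLocal L e dV hdV dW hdW hdV0 hdW0
  exact hlatU_of_latticeLocal L e dV hdV dW hdW hdV0 hdW0 D Bad hD hloc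

end Summit.HodgeConjecture.HodgeConjecture.Cruxes.HLiu418.K2LiuKindOneLineLatticeLocal

end
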